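import Literature.Geometry.Symplectic.TaubesFamilyCurvatureIntegral
import HarnessLib

/-!
# Taubes's family has no reducible solutions for `r > 0` (Taubes 1994, Lemma 4)

Topic `Literature/Geometry/Symplectic`; a corollary of `TaubesFamilyCurvatureIntegral` (the
integrated `ω`-component `∫_N (|ψ₁|² - |ψ₀|² - |c|²) s ∧ s = 0` for every solution of the
Seiberg–Witten equations with perturbation `P₊F_{A₀} - (|c|²/4)·s`, `r = |c|²`).

Taubes 1994, Lemma 4 (p. 815): "For no `r ≥ 0` does (6) have a solution with `ψ = 0`.  Proof. Such a
solution would have `P₊F_A = P₊F_{A₀} - i·ω`.  If such were the case, then `F_A` and `F_{A₀}` would not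
be cohomologous, and so `A` would not be a connection on `K⁻¹`."  For the family (5.2) of Taubes
1995 (`P₊F_A = ¼τ(ψ ⊗ ψ*) + P₊F_{A₀} - (i/4) r ω`) the same argument applies for `r > 0` (at `r = 0`
the reducible `(A₀, 0)` does solve): with `ψ = 0` the identity reads `-|c|² ∫_N s ∧ s = 0`, while
`∫_N s ∧ s > 0` for the volume form of the (non-empty) closed symplectic manifold.

* `isIrreducible_of_isSolution`: for `c ≠ 0`, **every solution of `(SW_η)`, `η = P₊F_{A₀} - (|c|²/4)s`,
  is irreducible** (`ψ ≢ 0`);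
* `not_isSolution_ofConnection`: in particular no `(A, 0)` solves.

PROVED, 0 named facts.

## References

* C. H. Taubes, *The Seiberg–Witten invariants and symplectic forms*, Math. Res. Lett. 1 (1994)
  809–822, §2 Lemma 4 (p. 815). [Taubes1994]
* C. H. Taubes, *The Seiberg–Witten and Gromov invariants*, Math. Res. Lett. 2 (1995) 221–238,
  §5 (5.2). [Taubes1995]
-/

noncomputable section

open scoped Manifold ContDiff
open Set Complex Literature.Geometry.Kaehler Literature.Geometry.GaugeTheory Literature.Topology.FourManifolds
open Literature.Geometry.Lorentzian (PseudoRiemannianMetric)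
open Literature.Geometry.Manifold Literature.Geometry.Manifold.DeRhamSignFour Literature.NumberTheory.Transcendental

namespace Literature.Geometry.Symplectic

namespace AlmostComplexStructure.IsCompatibleWith

variable {N : Type} [TopologicalSpace N] [T2Space N] [CompactSpace N] [Nonempty N]
  [ChartedSpace (EuclideanSpace ℝ (Fin 4)) N] [IsManifold (𝓡 4) ∞ N]
  {J : AlmostComplexStructure (𝓡 4) ∞ N} {s : MForm (𝓡 4) N ℝ 2}
  (h : J.IsCompatibleWith s) (hs : IsSmoothForm s)
  (hnd : ∀ x (v : TangentSpace (𝓡 4) x), v ≠ 0 → ∃ w : TangentSpace (𝓡 4) x, s x ![v, w] ≠ 0)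
  [(h.metric hs).HasLeviCivita]

/-- **Taubes 1994, Lemma 4, for the family (5.2): every solution is irreducible when `r = |c|² > 0`.**
On a non-empty closed symplectic `4`-manifold `(N, s)` with compatible `J`, for `c ≠ 0` every
(smooth) solution `(A, ψ)` of the Seiberg–Witten equations with perturbation `P₊F_{A₀} - (|c|²/4)·s`
has `ψ ≢ 0`: otherwise the integrated `ω`-component gives `-|c|² ∫_N s∧s = 0`, but `∫_N s∧s > 0`
("`F_A` and `F_{A₀}` would not be cohomologous"). [cite: Taubes1994, §2 Lemma 4 (p. 815)] -/
theorem isIrreducible_of_isSolution (hcl : IsClosedForm s) {c : ℂ} (hc : c ≠ 0)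
    {cfg : (h.canonicalSpincStructure hs hnd).Configuration}
    (hsol : SpincStructure.IsSolution (h.taubesPerturbation hs hnd - h.symplecticPerturbation hs hnd (Complex.normSq c / 4)) cfg) :
    cfg.IsIrreducible := by
  intro hred
  have hv : IsSmoothForm ((s.wedge s).castDeg two_add_two_eq_four) := (wedge_self_castDeg_mem_closedSmoothForms ⟨hs, hcl⟩).1
  have hne := wedge_self_castDeg_apply_ne_zero s hnd
  have hI := h.integral_normSq_sub_smul_wedge_self_eq_zero hs hnd hcl c hsol
  have hψ : ∀ x (a : Fin 2), cfg.plusSpinor ((h.canonicalSpincStructure hs hnd).indexAt x) x a = 0 := fun x a ↦ by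
    simp only [SpincStructure.Configuration.plusSpinor, hred _ x ((h.canonicalSpincStructure hs hnd).mem_baseSet_indexAt x),
      Pi.zero_apply]
  have hfun : ((fun x ↦ Complex.normSq (cfg.plusSpinor ((h.canonicalSpincStructure hs hnd).indexAt x) x 1) -
        Complex.normSq (cfg.plusSpinor ((h.canonicalSpincStructure hs hnd).indexAt x) x 0) - Complex.normSq c) •
          (s.wedge s).castDeg two_add_two_eq_four : MForm (𝓡 4) N ℝ 4) =
      (-Complex.normSq c) • (s.wedge s).castDeg two_add_two_eq_four := by
    funext x
    ext w
    simp [hψ x]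
  rw [hfun, MForm.integral_smul] at hI
  have hpos := integral_self_pos hv hne
  have hc2 : 0 < Complex.normSq c := Complex.normSq_pos.2 hc
  nlinarith

/-- **No reducible solutions `(A, 0)` for `r > 0`** (Taubes 1994, Lemma 4, for the family (5.2)).
[cite: Taubes1994, §2 Lemma 4 (p. 815)] -/
theorem not_isSolution_ofConnection (hcl : IsClosedForm s) {c : ℂ} (hc : c ≠ 0)
    (A : (h.canonicalSpincStructure hs hnd).detLineBundle.Connection) :
    ¬SpincStructure.IsSolution (h.taubesPerturbation hs hnd - h.symplecticPerturbation hs hnd (Complex.normSq c / 4))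
      (SpincStructure.Configuration.ofConnection A) := fun hsol ↦
  h.isIrreducible_of_isSolution hs hnd hcl hc hsol (SpincStructure.Configuration.isReducible_ofConnection A)

end AlmostComplexStructure.IsCompatibleWith

end Literature.Geometry.Symplectic

end
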